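import Mathlib
import Summits.Parity.BatemanHorn.Theses.AlmostPrimeZeros

/-!
# Sketch — crux-ideate stmt-Parity-11291 (SystemZeroRepulsion), ideator 2, round 1

First-lemma signatures for the three idea cards (they only need to ELABORATE here):

* card A `smooth-rough-lattice-acquisition`:
  `SmoothZeroRepulsionLogPower` (periodic regime, provable now), `RoughRepulsion` (transfer fragment),
* card B `newton-turan-cumulant-disc`:
  `PowerSumLogDeriv` (power sums of 1/(1-ρ) = Taylor data of P'/P at 1, provable now),
  `NewtonTuranDisc` (geometric power-sum bounds ⟹ zero-free disc at 1, provable now),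
* card C `far-zone-hardy-ramanujan-along-f`:
  `JensenTail` (Rankin–Jensen tail inequality for nonnegative-coefficient polynomials, provable now),
  `FarMomentAlongSystem` (the parity-free anatomy sub-crux), `FarZoneHarmless` (its consequence).
-/

namespace Summit.Parity.BatemanHorn.Cruxes.SystemZeroRepulsion.Sketch

open scoped BigOperators
open MeasureTheory Classical

/-- card A, first lemma (periodic regime; provable now by CRT-periodicity mod `∏_{p ≤ y} p²` and Rouché):
the zero statistic of the almost-prime polynomial of the `y`-SMOOTH capped statistic, `y = √(log x)`,
is bounded for every Bateman–Horn system (its zeros are the zeros of the local factors `E_p`, `p ≤ y`). -/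
def SmoothZeroRepulsionLogPower : Prop :=
  ∀ (k : ℕ) (f : Fin k → Polynomial ℤ), Literature.NumberTheory.Sieve.IsBatemanHornSystem f →
    ∃ C : ℝ, ∀ x : ℕ, 3 ≤ x →
      ((∑ n ∈ Finset.range (x + 1), (Polynomial.X : Polynomial ℂ) ^
          (∑ i, (((f i).eval (n : ℤ)).toNat.factorization.sum
            fun p v => if (p : ℝ) ≤ Real.sqrt (Real.log (x : ℝ)) then min v 2 else 0))).roots.map
        (fun ρ : ℂ => (‖(1 : ℂ) - ρ‖ ^ 2)⁻¹)).sum ≤ C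

/-- card A, transfer fragment `RoughRepulsion`: the same zero statistic for the ROUGH capped count
(primes `p > exp(√(log x))` only) is bounded — the Γ-lattice acquisition by the rough-count polynomial. -/
def RoughRepulsion : Prop :=
  ∀ (k : ℕ) (f : Fin k → Polynomial ℤ), Literature.NumberTheory.Sieve.IsBatemanHornSystem f →
    ∃ C : ℝ, ∀ x : ℕ, 3 ≤ x →
      ((∑ n ∈ Finset.range (x + 1), (Polynomial.X : Polynomial ℂ) ^
          (∑ i, (((f i).eval (n : ℤ)).toNat.factorization.sum
            fun p v => if Real.exp (Real.sqrt (Real.log (x : ℝ))) < (p : ℝ) then min v 2 else 0))).roots.map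
        (fun ρ : ℂ => (‖(1 : ℂ) - ρ‖ ^ 2)⁻¹)).sum ≤ C

/-- card B, first lemma (provable now): the power sums `p_m = Σ_ρ (1-ρ)^{-m}` of the inverse zero
displacements are the Taylor coefficients of the logarithmic derivative at the non-root `1`:
`(d/dw)^{m-1} (P'/P)(1+w) |_{w=0} = (-1)^{m-1} (m-1)! p_m`; for `P = S_x` the left side is
`(-1)^{m-1}(m-1)!`-free bookkeeping of the factorial cumulants of `s_f` (m = 1: mean; m = 2: `m₁ - v`). -/
def PowerSumLogDeriv : Prop :=
  ∀ (P : Polynomial ℂ), P.eval 1 ≠ 0 → ∀ m : ℕ, 1 ≤ m →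
    iteratedDeriv (m - 1) (fun w : ℂ => (Polynomial.derivative P).eval (1 + w) / P.eval (1 + w)) 0 =
      (-1 : ℂ) ^ (m - 1) * ((m - 1).factorial : ℂ) * (P.roots.map (fun ρ : ℂ => ((1 : ℂ) - ρ)⁻¹ ^ m)).sum

/-- card B, first lemma (provable now; Newton identities + Cauchy's root bound): geometric bounds
`|p_m| ≤ A^m` on the power sums for `1 ≤ m ≤ deg P` force a zero-free disc `|z - 1| ≥ 1/(4A)`. -/
def NewtonTuranDisc : Prop :=
  ∀ (P : Polynomial ℂ) (A : ℝ), 0 < A → P.eval 1 ≠ 0 →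
    (∀ m : ℕ, 1 ≤ m → m ≤ P.natDegree →
      ‖(P.roots.map (fun ρ : ℂ => ((1 : ℂ) - ρ)⁻¹ ^ m)).sum‖ ≤ A ^ m) →
    ∀ ρ ∈ P.roots, (4 * A)⁻¹ ≤ ‖(1 : ℂ) - ρ‖

/-- card C, first lemma (provable now; Jensen at centre 1 + `|P(z)| ≤ P(|z|)` for nonnegative
coefficients + integration by parts): the far part of the zero statistic is bounded by a weighted
integral of the logarithmic moment `log (P(1+er)/P(1))`. -/
def JensenTail : Prop :=
  ∀ (P : Polynomial ℝ), (∀ i : ℕ, 0 ≤ P.coeff i) → P.eval 1 ≠ 0 → ∀ R : ℝ, 1 ≤ R →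
    (((P.map (algebraMap ℝ ℂ)).roots.filter (fun ρ : ℂ => R ≤ ‖(1 : ℂ) - ρ‖)).map
        (fun ρ : ℂ => (‖(1 : ℂ) - ρ‖ ^ 2)⁻¹)).sum ≤
      2 * ∫ r in Set.Ioi R, Real.log (P.eval (1 + Real.exp 1 * r) / P.eval 1) * (r ^ 3)⁻¹

/-- card C, the parity-free anatomy sub-crux `FarMomentAlongSystem` ("Hardy–Ramanujan inequality along f
in exponential-moment form, uniformly for tilts `t ≤ √(log x)`"): for every Bateman–Horn system,
`Σ_{n ≤ x} t^{s_f(n)} ≤ (x+1)·exp(C t loglog x)`. Trivial for `k = 1`, `f = X`; open for `deg ≥ 2` or `k ≥ 2`. -/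
def FarMomentAlongSystem : Prop :=
  ∀ (k : ℕ) (f : Fin k → Polynomial ℤ), Literature.NumberTheory.Sieve.IsBatemanHornSystem f →
    ∃ C : ℝ, ∀ x : ℕ, 3 ≤ x → ∀ t : ℝ, 1 ≤ t → t ≤ Real.sqrt (Real.log (x : ℝ)) →
      (∑ n ∈ Finset.range (x + 1),
          t ^ (∑ i, (((f i).eval (n : ℤ)).toNat.factorization.sum fun _ v => min v 2))) ≤
        ((x : ℝ) + 1) * Real.exp (C * t * Real.log (Real.log (x : ℝ)))

/-- card C, consequence any line needs (`JensenTail` + `FarMomentAlongSystem` ⟹ this): zeros at distance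
`≥ (loglog x)²` from `1` contribute `O(1)` to the zero statistic, for every Bateman–Horn system. -/
def FarZoneHarmless : Prop :=
  ∀ (k : ℕ) (f : Fin k → Polynomial ℤ), Literature.NumberTheory.Sieve.IsBatemanHornSystem f →
    ∃ C : ℝ, ∀ x : ℕ, 3 ≤ x →
      (((∑ n ∈ Finset.range (x + 1), (Polynomial.X : Polynomial ℂ) ^
          (∑ i, (((f i).eval (n : ℤ)).toNat.factorization.sum fun _ v => min v 2))).roots.filter
          (fun ρ : ℂ => Real.log (Real.log (x : ℝ)) ^ 2 ≤ ‖(1 : ℂ) - ρ‖)).map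
        (fun ρ : ℂ => (‖(1 : ℂ) - ρ‖ ^ 2)⁻¹)).sum ≤ C

/-- Sanity: the crux decl is in scope (type-checks as a Prop). -/
example : Prop := Summit.Parity.BatemanHorn.Theses.AlmostPrimeZeros.SystemZeroRepulsion

/-- The far-moment reduction target shape: `JensenTail ∧ FarMomentAlongSystem → FarZoneHarmless`
(to be proved in crux-plan; stated here only to fix the intended logical shape). -/
def FarZoneReduction : Prop := JensenTail → FarMomentAlongSystem → FarZoneHarmless

end Summit.Parity.BatemanHorn.Cruxes.SystemZeroRepulsion.Sketch
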